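import Literature.NumberTheory.EllipticCurves.KrizLi2019.TwoPartBSDTwists
import Literature.NumberTheory.EllipticCurves.Zhai2021.TwoAdicLowerBoundTwists
import HarnessLib

/-!
# Kriz–Li 2019 (FMS 7, e15), §6 Table 1 («Assumption (★) for rank one curves») — the four rank-one rows ADDITIVE at `2` with `c₂(E) = 3` and a
# check-mark: `124a1 | −15 | 3 | ✓`, `148a1 | −7 | 3 | ✓`, `172a1 | −7 | 3 | ✓`, `196a1 | −31 | 3 | ✓` AS PRINTED (statement-only named facts; the per-curve
# inputs of Thm 5.1 (2) = `thm112_bsdTwo_twist`, whose Manin-constant clause is live exactly at these rows — hence the OPTIMAL datum is transcribed)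

HONEST FRAMING (cell `bsd-f1-sign2`, seat `bsd-line-gk2-p2` g34, crux U₂ `MinimalTwinBSDTwo` stmt-BirchSwinnertonDyer-22985, LINE 23 «twin_swap»;
2026-08-31): four PUBLISHED per-curve computational assertions (check-marks in a table of a refereed paper) vendored as named `Prop`s — nothing asserted,
nothing discharged (D-0014) — with a locator into the held source; same shape as `table1_row92b1` (the other additive-at-`2` rank-one row, seat
`bsd-2adic-k4-w2`): for an ADDITIVE `2` Thm 5.1 (2) needs the Manin constant of the optimal parametrisation odd, so «optimal» is part of the transcription
(`Zhai2021.IsOptimalDatum`; consumers derive `Odd Dt.c` from Agashe–Ribet–Stein Thm. 2.6 / Cremona, tree fact `cremona_abs_maninConstant_eq_one_of_level_le`).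
The Weierstrass models are Cremona's reduced minimal models as recorded in the tree's kit census `Literature/…/HypothesisSweep/RecordsN000116to000177.lean` /
`…N000178to000233.lean`.  Consumers (this seat): `…KrizLiAnchor148a1/172a1.lean` (Kodaira `IV*` at `2`, `d_K = −7`); `124a1` (`d_K = −15` composite) and
`196a1` (`N = 2²·7²`, two additive primes) are transcribed for later seats.  Nothing is booked here; BSD is not proved by any of this.

Source. D. Kriz, C. Li, *Goldfeld's conjecture and congruences between Heegner points*, Forum Math. Sigma **7** (2019), e15, doi:10.1017/fms.2019.9
[KrizLi2019] = arXiv:1606.03172 (§§1–6). Texts read: the held chunk text `paper:doi-10-1017-fms-2019-9` (p0017 L21: Example 6.2), which DROPS the table body;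
the table itself was read in the arXiv v3 source `Congruence.tex` (copy at `run/shared/lean/pub/bsd-print-cf2/lit/krizli2019/arXiv-1606.03172v3-Congruence.tex`),
ll. 964–1017 (`\label{{tab:1}}`, Example 6.2), rows at lines 980 (`124a1 & -15 & 3 & \checkmark`), 987 (`148a1 & -7 & 3 & \checkmark`), 992
(`172a1 & -7 & 3 & \checkmark`), 998 (`196a1 & -31 & 3 & \checkmark`).

## The printed statement (verbatim)

* Example 6.2 (tex l. 965): "We search for rank one optimal elliptic curves with `E(ℚ)[2] = 0` satisfying these two necessary conditions. There are 38
  such curves of conductor `≤ 300`. For each curve, we choose `K` with smallest `|d_K|` satisfying the Heegner hypothesis for `N` and such that `2` is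
  split in `K`. Then 31 out of 38 curves satisfy (★). See Table 1. The first three columns list `E`, `d_K` and the local Tamagawa number `c₂(E)` at `2`
  respectively. A check-mark in the last column means that (★) holds … If `c₂(E)` is further odd (true for 23 out of 31), then the application to BSD(2)
  (Theorem 5.1) also applies."
* Table 1, caption "Assumption (★) for rank one curves", header `E | d_K | c₂(E) | ★`, the rows transcribed here: "`124a1 & -15 & 3 & ✓`",
  "`148a1 & -7 & 3 & ✓`", "`172a1 & -7 & 3 & ✓`", "`196a1 & -31 & 3 & ✓`".

## Transcription (tree dictionary of `KrizLi2019/TwoPartBSDTwists.lean`)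

Models: `124a1 = [0,1,0,−2,1]` (`Δ = −2⁴·31`), `148a1 = [0,−1,0,−5,1]` (`Δ = 2⁸·37`), `172a1 = [0,1,0,−13,15]` (`Δ = −2⁸·43`), `196a1 = [0,−1,0,−2,1]`
(`Δ = 2⁴·7²`).  "`K = ℚ(√d_K)`" = any `K` with `IsImaginaryQuadratic K` and `NumberField.discr K = d_K`.  "Optimal curve with its parametrisation" = a datum
`Dt : ModularParametrizationData E N` at the conductor level (`NeZero` witness packed) with `Zhai2021.IsOptimalDatum E Dt`; "(★) holds" = a Heegner datum `H`,
an embedding `ι`, a point `P ∈ E(K)` mapping to `heegnerPointComplex Dt H`, and `j : K →ₐ[ℚ] ℚ₂` with `AssumptionStar E Dt K P j`.  Global minimality of the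
printed model is a binder `[IsGloballyMinimal]`.  "Rank one", "`E(ℚ)[2] = 0`", "`c₂(E) = 3`" are NOT transcribed (kernel-side in the consumer).  Nothing
weaker or stronger is transcribed; no `_holds` is expected.  Status: PUB (refereed); per-curve computational TABLE entries, flag word for the referee: TABLE.

## References
* [KrizLi2019] §6 Example 6.2 and Table 1 (FMS chunk p0017 L21; arXiv:1606.03172v3 `Congruence.tex` ll. 965, 980, 987, 992, 998); Assumption (★) (arXiv p0003 L45–L48).
* [CremonaAlgorithms1997] Table 1 (curves 124A1, 148A1, 172A1, 196A1).
* [Zhai2021BSDExactFormulaTwists] §1 (the optimality predicate `IsOptimalDatum`).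
-/

noncomputable section

open scoped Classical

open NumberField WeierstrassCurve Literature.NumberTheory.EllipticCurves
  Literature.NumberTheory.EllipticCurves.ModularForms

namespace Literature.NumberTheory.EllipticCurves.KrizLi2019

/-- **Kriz–Li 2019, §6 Table 1, row `124a1`** (`124a1 | d_K = -15 | c₂(E) = 3 | ★ ✓`; Example 6.2): for every imaginary quadratic field `K` of discriminant
`-15`, the optimal curve `124a1` on its (globally minimal) model `[0,1,0,-2,1]` (`y² = x³ + x² − 2x + 1`; `Δ = −2⁴·31`, `N = 2²·31`, additive at `2`) admits an
OPTIMAL modular parametrisation datum `Dt` at level `N(E)`, a Heegner datum `H` of discriminant `d_K` and level `N(E)`, an embedding `ι : K → ℂ`, a point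
`P ∈ E(K)` mapping to `heegnerPointComplex Dt H`, and `j : K → ℚ₂` with `AssumptionStar E Dt K P j`.  Statement only; TABLE entry; no `_holds` expected.
[cite: KrizLi2019, §6 Table 1 (row 124a1) and Example 6.2 (FMS 7 (2019) e15, chunk p0017 L21; arXiv:1606.03172v3 Congruence.tex ll. 965, 980)] -/
def table1_row124a1 : Prop :=
  ∀ [(⟨0, 1, 0, -2, 1⟩ : WeierstrassCurve ℚ).IsGloballyMinimal]
    (K : Type) [Field K] [NumberField K], IsImaginaryQuadratic K → NumberField.discr K = -15 →
    ∃ (_ : NeZero ((⟨0, 1, 0, -2, 1⟩ : WeierstrassCurve ℚ).conductorNorm ℤ))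
      (Dt : ModularParametrizationData (⟨0, 1, 0, -2, 1⟩ : WeierstrassCurve ℚ) ((⟨0, 1, 0, -2, 1⟩ : WeierstrassCurve ℚ).conductorNorm ℤ))
      (H : HeegnerDatum ((⟨0, 1, 0, -2, 1⟩ : WeierstrassCurve ℚ).conductorNorm ℤ) (NumberField.discr K))
      (ι : K →+* ℂ) (P : ((⟨0, 1, 0, -2, 1⟩ : WeierstrassCurve ℚ).baseChange K).toAffine.Point) (j : K →ₐ[ℚ] ℚ_[2]),
      Zhai2021.IsOptimalDatum (⟨0, 1, 0, -2, 1⟩ : WeierstrassCurve ℚ) Dt ∧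
        WeierstrassCurve.Affine.Point.map ι.toRatAlgHom P = heegnerPointComplex Dt H ∧
          AssumptionStar (⟨0, 1, 0, -2, 1⟩ : WeierstrassCurve ℚ) Dt K P j

/-- **Kriz–Li 2019, §6 Table 1, row `148a1`** (`148a1 | d_K = -7 | c₂(E) = 3 | ★ ✓`; Example 6.2): for every imaginary quadratic field `K` of discriminant
`-7`, the optimal curve `148a1` on its (globally minimal) model `[0,-1,0,-5,1]` (`y² = x³ − x² − 5x + 1`; `Δ = 2⁸·37`, `N = 2²·37`, additive at `2`) admits an
OPTIMAL modular parametrisation datum `Dt` at level `N(E)`, a Heegner datum `H` of discriminant `d_K` and level `N(E)`, an embedding `ι : K → ℂ`, a point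
`P ∈ E(K)` mapping to `heegnerPointComplex Dt H`, and `j : K → ℚ₂` with `AssumptionStar E Dt K P j`.  Statement only; TABLE entry; no `_holds` expected.
[cite: KrizLi2019, §6 Table 1 (row 148a1) and Example 6.2 (FMS 7 (2019) e15, chunk p0017 L21; arXiv:1606.03172v3 Congruence.tex ll. 965, 987)] -/
def table1_row148a1 : Prop :=
  ∀ [(⟨0, -1, 0, -5, 1⟩ : WeierstrassCurve ℚ).IsGloballyMinimal]
    (K : Type) [Field K] [NumberField K], IsImaginaryQuadratic K → NumberField.discr K = -7 →
    ∃ (_ : NeZero ((⟨0, -1, 0, -5, 1⟩ : WeierstrassCurve ℚ).conductorNorm ℤ))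
      (Dt : ModularParametrizationData (⟨0, -1, 0, -5, 1⟩ : WeierstrassCurve ℚ) ((⟨0, -1, 0, -5, 1⟩ : WeierstrassCurve ℚ).conductorNorm ℤ))
      (H : HeegnerDatum ((⟨0, -1, 0, -5, 1⟩ : WeierstrassCurve ℚ).conductorNorm ℤ) (NumberField.discr K))
      (ι : K →+* ℂ) (P : ((⟨0, -1, 0, -5, 1⟩ : WeierstrassCurve ℚ).baseChange K).toAffine.Point) (j : K →ₐ[ℚ] ℚ_[2]),
      Zhai2021.IsOptimalDatum (⟨0, -1, 0, -5, 1⟩ : WeierstrassCurve ℚ) Dt ∧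
        WeierstrassCurve.Affine.Point.map ι.toRatAlgHom P = heegnerPointComplex Dt H ∧
          AssumptionStar (⟨0, -1, 0, -5, 1⟩ : WeierstrassCurve ℚ) Dt K P j

/-- **Kriz–Li 2019, §6 Table 1, row `172a1`** (`172a1 | d_K = -7 | c₂(E) = 3 | ★ ✓`; Example 6.2): for every imaginary quadratic field `K` of discriminant
`-7`, the optimal curve `172a1` on its (globally minimal) model `[0,1,0,-13,15]` (`y² = x³ + x² − 13x + 15`; `Δ = −2⁸·43`, `N = 2²·43`, additive at `2`) admits an
OPTIMAL modular parametrisation datum `Dt` at level `N(E)`, a Heegner datum `H` of discriminant `d_K` and level `N(E)`, an embedding `ι : K → ℂ`, a point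
`P ∈ E(K)` mapping to `heegnerPointComplex Dt H`, and `j : K → ℚ₂` with `AssumptionStar E Dt K P j`.  Statement only; TABLE entry; no `_holds` expected.
[cite: KrizLi2019, §6 Table 1 (row 172a1) and Example 6.2 (FMS 7 (2019) e15, chunk p0017 L21; arXiv:1606.03172v3 Congruence.tex ll. 965, 992)] -/
def table1_row172a1 : Prop :=
  ∀ [(⟨0, 1, 0, -13, 15⟩ : WeierstrassCurve ℚ).IsGloballyMinimal]
    (K : Type) [Field K] [NumberField K], IsImaginaryQuadratic K → NumberField.discr K = -7 →
    ∃ (_ : NeZero ((⟨0, 1, 0, -13, 15⟩ : WeierstrassCurve ℚ).conductorNorm ℤ))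
      (Dt : ModularParametrizationData (⟨0, 1, 0, -13, 15⟩ : WeierstrassCurve ℚ) ((⟨0, 1, 0, -13, 15⟩ : WeierstrassCurve ℚ).conductorNorm ℤ))
      (H : HeegnerDatum ((⟨0, 1, 0, -13, 15⟩ : WeierstrassCurve ℚ).conductorNorm ℤ) (NumberField.discr K))
      (ι : K →+* ℂ) (P : ((⟨0, 1, 0, -13, 15⟩ : WeierstrassCurve ℚ).baseChange K).toAffine.Point) (j : K →ₐ[ℚ] ℚ_[2]),
      Zhai2021.IsOptimalDatum (⟨0, 1, 0, -13, 15⟩ : WeierstrassCurve ℚ) Dt ∧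
        WeierstrassCurve.Affine.Point.map ι.toRatAlgHom P = heegnerPointComplex Dt H ∧
          AssumptionStar (⟨0, 1, 0, -13, 15⟩ : WeierstrassCurve ℚ) Dt K P j

/-- **Kriz–Li 2019, §6 Table 1, row `196a1`** (`196a1 | d_K = -31 | c₂(E) = 3 | ★ ✓`; Example 6.2): for every imaginary quadratic field `K` of discriminant
`-31`, the optimal curve `196a1` on its (globally minimal) model `[0,-1,0,-2,1]` (`y² = x³ − x² − 2x + 1`; `Δ = 2⁴·7²`, `N = 2²·7²`, additive at `2`) admits an
OPTIMAL modular parametrisation datum `Dt` at level `N(E)`, a Heegner datum `H` of discriminant `d_K` and level `N(E)`, an embedding `ι : K → ℂ`, a point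
`P ∈ E(K)` mapping to `heegnerPointComplex Dt H`, and `j : K → ℚ₂` with `AssumptionStar E Dt K P j`.  Statement only; TABLE entry; no `_holds` expected.
[cite: KrizLi2019, §6 Table 1 (row 196a1) and Example 6.2 (FMS 7 (2019) e15, chunk p0017 L21; arXiv:1606.03172v3 Congruence.tex ll. 965, 998)] -/
def table1_row196a1 : Prop :=
  ∀ [(⟨0, -1, 0, -2, 1⟩ : WeierstrassCurve ℚ).IsGloballyMinimal]
    (K : Type) [Field K] [NumberField K], IsImaginaryQuadratic K → NumberField.discr K = -31 →
    ∃ (_ : NeZero ((⟨0, -1, 0, -2, 1⟩ : WeierstrassCurve ℚ).conductorNorm ℤ))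
      (Dt : ModularParametrizationData (⟨0, -1, 0, -2, 1⟩ : WeierstrassCurve ℚ) ((⟨0, -1, 0, -2, 1⟩ : WeierstrassCurve ℚ).conductorNorm ℤ))
      (H : HeegnerDatum ((⟨0, -1, 0, -2, 1⟩ : WeierstrassCurve ℚ).conductorNorm ℤ) (NumberField.discr K))
      (ι : K →+* ℂ) (P : ((⟨0, -1, 0, -2, 1⟩ : WeierstrassCurve ℚ).baseChange K).toAffine.Point) (j : K →ₐ[ℚ] ℚ_[2]),
      Zhai2021.IsOptimalDatum (⟨0, -1, 0, -2, 1⟩ : WeierstrassCurve ℚ) Dt ∧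
        WeierstrassCurve.Affine.Point.map ι.toRatAlgHom P = heegnerPointComplex Dt H ∧
          AssumptionStar (⟨0, -1, 0, -2, 1⟩ : WeierstrassCurve ℚ) Dt K P j

end Literature.NumberTheory.EllipticCurves.KrizLi2019

end
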